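import Literature.NumberTheory.DiophantineGeometry.FunctionFieldConstantExtensionGenusProofs
import HarnessLib

/-!
# A place above `P` for each irreducible factor of the reduced minimal polynomial (Kummer's theorem,
existence half; Stichtenoth Thm. 3.3.7)

Topic: `Literature/NumberTheory/DiophantineGeometry`. Let `F'/F` be a finite separable extension of
algebraic function fields over a finite field `K`, `P` a place of `F`, and `y ∈ F'` integral over `𝒪_P`
whose minimal polynomial over `F` is `φ ∈ 𝒪_P[T]` (monic). Let `γ ∈ F_P[T]` be a monic irreducible
factor of the reduction `φ̄` of `φ` modulo `P`. Then (**Kummer's theorem**, [Stichtenoth 2009,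
Thm. 3.3.7], the existence statement "there are places `P_i | P` with `φ_i(y) ∈ P_i`"):

* `PlaceOver.exists_placeOver_aeval_residue_eq_zero`: there is a place `P'` of `F'` above `P` with
  `y ∈ 𝒪_{P'}` and `γ(ȳ) = 0` in the residue field `F'_{P'}` (`ȳ = y mod P'`, `γ` read in `F'_{P'}[T]`
  through `F_P ⊆ F'_{P'}`);
* `PlaceOver.natDegree_mul_degree_le_degree`: for any such place, `deg γ · deg P ≤ deg P'`
  (`F_P[T]/(γ) ↪ F'_{P'}`; "`f(P_i|P) ≥ deg φ_i`").

Proof (the book's, through the ring `𝒪_P[y] ≅ 𝒪_P[T]/(φ)`): the homomorphism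
`𝒪_P[T] → F_P[T]/(γ)`, `T ↦ T̄`, kills `φ` (as `γ | φ̄`) and hence factors through
`𝒪_P[y] = im(𝒪_P[T] → 𝒪'_P)` (`ker = (φ)` because `𝒪_P` is integrally closed, Mathlib
`minpoly.ker_eval`); its kernel is a maximal ideal of `𝒪_P[y]`, which lies under a maximal ideal `𝔔` of
the integral closure `𝒪'_P` of `𝒪_P` in `F'` (lying over), and `𝔔` defines the place `P'`
(`PlaceOver.ofPrimeIntegralClosure`, the tree's bridge of `FunctionFieldHilbertRamification`). The
counting half of Kummer's theorem (`∑ eᵢ fᵢ = n` forces `e = 1` when `φ̄` is separable, and complete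
splitting when `φ̄` splits into distinct linear factors) is in `FunctionFieldDedekindKummer`.

## References

* H. Stichtenoth, *Algebraic Function Fields and Codes*, 2nd ed., GTM 254, Springer 2009: Thm. 3.3.7,
  Prop. 3.1.4, Def. 3.1.5. [Stichtenoth2009]
-/

noncomputable section

open scoped Classical Polynomial
open Polynomial IsDedekindDomain

namespace Literature.NumberTheory.DiophantineGeometry.AlgFunctionField

namespace PlaceOver

universe u v

variable {K : Type u} {F : Type v} {F' : Type v} [Field K] [Field F] [Algebra K F]
variable [Field F'] [Algebra F F'] [Algebra K F'] [IsScalarTower K F F']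

/-! ### The homomorphism `𝒪_P[T] → F_P[T]/(γ)` -/

section Hom

variable (P : PlaceOver K F) (φ : (P.toValuationSubring)[X]) {γ : (P.residueField)[X]}

/-- The evaluation `𝒪_P[T] → F_P[T]/(γ)`, `T ↦ T̄`, coefficients reduced modulo `P`. [folklore] -/
theorem eval₂_residue_root_eq (p : (P.toValuationSubring)[X]) :
    eval₂ ((AdjoinRoot.of γ).comp (IsLocalRing.residue P.toValuationSubring)) (AdjoinRoot.root γ) p =
      AdjoinRoot.mk γ (p.map (IsLocalRing.residue P.toValuationSubring)) := by
  rw [← eval₂_map, ← AdjoinRoot.aeval_eq, aeval_def, AdjoinRoot.algebraMap_eq]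

/-- It kills `φ` when `γ ∣ φ̄`. [folklore] -/
theorem eval₂_residue_root_eq_zero_of_dvd (hdvd : γ ∣ φ.map (IsLocalRing.residue P.toValuationSubring)) :
    eval₂ ((AdjoinRoot.of γ).comp (IsLocalRing.residue P.toValuationSubring)) (AdjoinRoot.root γ) φ = 0 := by
  rw [eval₂_residue_root_eq, AdjoinRoot.mk_eq_zero]
  exact hdvd

end Hom

/-! ### Existence of a place for each irreducible factor -/

section Residue

variable {P : PlaceOver K F} {P' : PlaceOver K F'}
  (hBP : ∀ x : F, algebraMap F F' x ∈ P'.toValuationSubring ↔ x ∈ P.toValuationSubring)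

omit [IsScalarTower K F F'] in
/-- Evaluation commutes with the inclusion `𝒪_P ⊆ 𝒪_{P'} ⊆ F'`: for `G ∈ 𝒪_P[T]` and `z ∈ 𝒪_{P'}`,
`G(z)` computed in `𝒪_{P'}` is `G(z)` computed in `F'`. [folklore] -/
theorem coe_eval_map_resHom (G : (P.toValuationSubring)[X]) (z : P'.toValuationSubring) :
    (((G.map (resHom P P' hBP)).eval z : P'.toValuationSubring) : F') =
      eval₂ (algebraMap P.toValuationSubring F') (z : F') G := by
  rw [eval_map, show ((eval₂ (resHom P P' hBP) z G : P'.toValuationSubring) : F') =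
    P'.toValuationSubring.subtype (eval₂ (resHom P P' hBP) z G) from rfl, hom_eval₂]
  rfl

omit [IsScalarTower K F F'] in
/-- Reduction commutes with the inclusion of residue fields: for `G ∈ 𝒪_P[T]` and `z ∈ 𝒪_{P'}`,
`Ḡ(z̄) = \overline{G(z)}` in `F'_{P'}`, where `Ḡ ∈ F_P[T]` is read in `F'_{P'}[T]`. [folklore] -/
theorem aeval_residue_map_map (G : (P.toValuationSubring)[X]) (z : P'.toValuationSubring) :
    aeval (IsLocalRing.residue P'.toValuationSubring z)
        ((G.map (IsLocalRing.residue P.toValuationSubring)).map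
          (IsLocalRing.ResidueField.map (resHom P P' hBP))) =
      IsLocalRing.residue P'.toValuationSubring ((G.map (resHom P P' hBP)).eval z) := by
  rw [Polynomial.map_map, IsLocalRing.ResidueField.map_comp_residue, ← Polynomial.map_map,
    aeval_def, eval₂_map, Algebra.algebraMap_self, RingHom.id_comp, eval₂_hom, eval_map]

end Residue

variable [IsAlgFunctionField K F] [FiniteDimensional F F'] [Algebra.IsSeparable F F'] [Finite K]
  [IsAlgFunctionField K F']

omit [Algebra K F'] [IsScalarTower K F F'] [IsAlgFunctionField K F] [FiniteDimensional F F']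
  [Algebra.IsSeparable F F'] [Finite K] [IsAlgFunctionField K F'] in
/-- `y` is integral over `𝒪_P` when its minimal polynomial over `F` has coefficients in `𝒪_P`, and then
that polynomial is its minimal polynomial over `𝒪_P` (`𝒪_P` is integrally closed). [folklore] -/
theorem isIntegral_and_minpoly_eq_of_minpoly_eq_map (P : PlaceOver K F) {y : F'}
    {φ : (P.toValuationSubring)[X]} (hφm : φ.Monic)
    (hφ : minpoly F y = φ.map (algebraMap P.toValuationSubring F)) :
    IsIntegral P.toValuationSubring y ∧ minpoly P.toValuationSubring y = φ := by
  have hint : IsIntegral P.toValuationSubring y := by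
    refine ⟨φ, hφm, ?_⟩
    have h := minpoly.aeval F y
    rw [hφ, aeval_map_algebraMap, aeval_def] at h
    exact h
  refine ⟨hint, ?_⟩
  have h := minpoly.isIntegrallyClosed_eq_field_fractions' F hint
  rw [hφ] at h
  exact (Polynomial.map_injective _ (FaithfulSMul.algebraMap_injective _ _) h).symm

omit [IsScalarTower K F F'] [IsAlgFunctionField K F] [IsAlgFunctionField K F'] in
/-- **Kummer's theorem, existence half** (Stichtenoth Thm. 3.3.7): for a (monic) irreducible factor
`γ` of `φ̄ = φ mod P`, where `φ ∈ 𝒪_P[T]` is monic with `φ = minpoly_F(y)`, `y ∈ F'`, there is a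
place `P'` of `F'` above `P` with `y ∈ 𝒪_{P'}` and `γ(ȳ) = 0` in `F'_{P'}`.
[cite: Stichtenoth2009, Thm. 3.3.7] -/
theorem exists_placeOver_aeval_residue_eq_zero (P : PlaceOver K F) {y : F'}
    {φ : (P.toValuationSubring)[X]} (hφm : φ.Monic)
    (hφ : minpoly F y = φ.map (algebraMap P.toValuationSubring F))
    {γ : (P.residueField)[X]} (hγ : Irreducible γ)
    (hdvd : γ ∣ φ.map (IsLocalRing.residue P.toValuationSubring)) :
    ∃ (P' : PlaceOver K F')
      (hBP : ∀ x : F, algebraMap F F' x ∈ P'.toValuationSubring ↔ x ∈ P.toValuationSubring)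
      (hy : y ∈ P'.toValuationSubring),
      aeval (IsLocalRing.residue P'.toValuationSubring ⟨y, hy⟩)
        (γ.map (IsLocalRing.ResidueField.map (resHom P P' hBP))) = 0 := by
  haveI : Fact (Irreducible γ) := ⟨hγ⟩
  obtain ⟨hyint, hmin⟩ := P.isIntegral_and_minpoly_eq_of_minpoly_eq_map hφm hφ
  set yB : integralClosure P.toValuationSubring F' :=
    ⟨y, (mem_integralClosure_iff P.toValuationSubring F').2 hyint⟩ with hyB
  have hyBint : IsIntegral P.toValuationSubring yB := integralClosure.isIntegral yB
  have hminB : minpoly P.toValuationSubring yB = φ := by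
    have h := minpoly.isIntegrallyClosed_eq_field_fractions F F' hyBint
    rw [show algebraMap _ F' yB = y from rfl, hφ] at h
    exact (Polynomial.map_injective _ (FaithfulSMul.algebraMap_injective _ _) h).symm
  -- `𝒪_P[T] → B`, `T ↦ y`, with kernel `(φ)`; `B` is integral over `𝒪_P[T]` through it
  set ev : (P.toValuationSubring)[X] →ₐ[P.toValuationSubring] integralClosure P.toValuationSubring F' :=
    aeval yB with hev
  letI : Algebra (P.toValuationSubring)[X] (integralClosure P.toValuationSubring F') :=
    ev.toRingHom.toAlgebra
  have halg : ∀ p : (P.toValuationSubring)[X],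
      algebraMap (P.toValuationSubring)[X] (integralClosure P.toValuationSubring F') p = ev p :=
    fun _ => rfl
  haveI : IsScalarTower P.toValuationSubring (P.toValuationSubring)[X]
      (integralClosure P.toValuationSubring F') :=
    IsScalarTower.of_algebraMap_eq fun c => by rw [halg, Polynomial.algebraMap_apply, hev, aeval_C]; rfl
  haveI : Algebra.IsIntegral (P.toValuationSubring)[X] (integralClosure P.toValuationSubring F') :=
    Algebra.IsIntegral.tower_top P.toValuationSubring
  have hker : RingHom.ker (algebraMap (P.toValuationSubring)[X]
      (integralClosure P.toValuationSubring F')) = Ideal.span {φ} := by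
    rw [RingHom.algebraMap_toAlgebra, hev, ← hminB]
    exact minpoly.ker_eval hyBint
  -- `ψ₀ : 𝒪_P[T] → F_P[T]/(γ)` is onto; its kernel is a maximal ideal containing `ker ev`
  set ψ₀ : (P.toValuationSubring)[X] →+* AdjoinRoot γ :=
    eval₂RingHom ((AdjoinRoot.of γ).comp (IsLocalRing.residue P.toValuationSubring)) (AdjoinRoot.root γ)
    with hψ₀def
  have hψ₀ : ∀ p : (P.toValuationSubring)[X],
      ψ₀ p = AdjoinRoot.mk γ (p.map (IsLocalRing.residue P.toValuationSubring)) := fun p =>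
    P.eval₂_residue_root_eq p
  have hψsurj : Function.Surjective ψ₀ := by
    intro l
    induction l using AdjoinRoot.induction_on with
    | ih p =>
      obtain ⟨q, rfl⟩ := Polynomial.map_surjective _ IsLocalRing.residue_surjective p
      exact ⟨q, hψ₀ q⟩
  set M : Ideal (P.toValuationSubring)[X] := RingHom.ker ψ₀ with hM
  haveI hMmax : M.IsMaximal := RingHom.ker_isMaximal_of_surjective ψ₀ hψsurj
  have hle : RingHom.ker (algebraMap (P.toValuationSubring)[X]
      (integralClosure P.toValuationSubring F')) ≤ M := by
    rw [hker, Ideal.span_singleton_le_iff_mem, hM, RingHom.mem_ker]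
    exact P.eval₂_residue_root_eq_zero_of_dvd φ hdvd
  have hMO : M.comap (algebraMap P.toValuationSubring (P.toValuationSubring)[X]) =
      IsLocalRing.maximalIdeal P.toValuationSubring := by
    ext c
    rw [Ideal.mem_comap, hM, RingHom.mem_ker, Polynomial.algebraMap_apply, hψ₀, Polynomial.map_C,
      AdjoinRoot.mk_C, map_eq_zero_iff _ (AdjoinRoot.of γ).injective, IsLocalRing.residue_eq_zero_iff]
    rfl
  -- lying over: a maximal ideal `𝔔` of `B` above `M`, hence above `P`
  obtain ⟨Q, hQmax, hQM⟩ := Ideal.exists_ideal_over_maximal_of_isIntegral M hle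
  have hQO : Q.comap (algebraMap P.toValuationSubring (integralClosure P.toValuationSubring F')) =
      IsLocalRing.maximalIdeal P.toValuationSubring := by
    rw [IsScalarTower.algebraMap_eq P.toValuationSubring (P.toValuationSubring)[X]
      (integralClosure P.toValuationSubring F'), ← Ideal.comap_comap, hQM, hMO]
  haveI hQlies : Q.LiesOver (IsLocalRing.maximalIdeal P.toValuationSubring) := ⟨hQO.symm⟩
  have hQbot : Q ≠ ⊥ :=
    Ideal.ne_bot_of_liesOver_of_ne_bot (IsDiscreteValuationRing.not_a_field P.toValuationSubring) _
  set v : HeightOneSpectrum (integralClosure P.toValuationSubring F') := ⟨Q, hQmax.isPrime, hQbot⟩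
    with hv
  haveI : v.asIdeal.LiesOver (IsLocalRing.maximalIdeal P.toValuationSubring) := hQlies
  -- the place of `𝔔`
  have hBP := algebraMap_mem_ofPrimeIntegralClosure_iff (K' := K) v
  have hy : y ∈ (ofPrimeIntegralClosure (K' := K) v).toValuationSubring :=
    coe_mem_of_mem_integralClosure _ hBP yB
  refine ⟨ofPrimeIntegralClosure (K' := K) v, hBP, hy, ?_⟩
  -- a lift `G` of `γ` has `G(y) ∈ 𝔔`, i.e. `Ḡ(ȳ) = γ(ȳ) = 0`
  obtain ⟨G, hG⟩ :=
    Polynomial.map_surjective (IsLocalRing.residue P.toValuationSubring) IsLocalRing.residue_surjective γ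
  have hGQ : ev G ∈ Q := by
    have : G ∈ Q.comap (algebraMap (P.toValuationSubring)[X]
        (integralClosure P.toValuationSubring F')) := by
      rw [hQM, hM, RingHom.mem_ker, hψ₀, hG, AdjoinRoot.mk_self]
    exact this
  have hval : HeightOneSpectrum.valuation F' v (ev G : F') < 1 :=
    (HeightOneSpectrum.valuation_lt_one_iff_mem v _).2 hGQ
  have hevalmem : ((G.map (resHom P _ hBP)).eval ⟨y, hy⟩ :
      (ofPrimeIntegralClosure (K' := K) v).toValuationSubring) ∈
      IsLocalRing.maximalIdeal (ofPrimeIntegralClosure (K' := K) v).toValuationSubring := by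
    rw [ValuationSubring.valuation_lt_one_iff]
    change ((v.valuation F').valuationSubring).valuation _ < 1
    rw [← (Valuation.isEquiv_valuation_valuationSubring (v.valuation F')).lt_one_iff_lt_one,
      coe_eval_map_resHom]
    convert hval using 2
    rw [hev, ← Subalgebra.aeval_coe, aeval_def]
  rw [← hG, aeval_residue_map_map, IsLocalRing.residue_eq_zero_iff]
  exact hevalmem

omit [IsScalarTower K F F'] [FiniteDimensional F F'] [Algebra.IsSeparable F F'] in
/-- **`deg γ · deg P ≤ deg P'`** when `γ ∈ F_P[T]` is irreducible and has the root `z̄ ∈ F'_{P'}`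
(`F_P[T]/(γ) ↪ F'_{P'}`, so `#F_P ^ deg γ ≤ #F'_{P'}`; Stichtenoth Thm. 3.3.7: `f(P_i|P) ≥ deg φ_i`).
[cite: Stichtenoth2009, Thm. 3.3.7] -/
theorem natDegree_mul_degree_le_degree {P : PlaceOver K F} {P' : PlaceOver K F'}
    (hBP : ∀ x : F, algebraMap F F' x ∈ P'.toValuationSubring ↔ x ∈ P.toValuationSubring)
    {γ : (P.residueField)[X]} (hγ : Irreducible γ) (z : P'.toValuationSubring)
    (hz : aeval (IsLocalRing.residue P'.toValuationSubring z)
      (γ.map (IsLocalRing.ResidueField.map (resHom P P' hBP))) = 0) :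
    γ.natDegree * P.degree ≤ P'.degree := by
  -- (computed before `AdjoinRoot γ` is given its field structure, to keep a single `F_P`-algebra
  -- structure on it in play)
  have hL : Nat.card (AdjoinRoot γ) = Nat.card P.residueField ^ γ.natDegree := by
    rw [Nat.card_congr (AdjoinRoot.powerBasis hγ.ne_zero).basis.equivFun.toEquiv, Nat.card_fun,
      Nat.card_eq_fintype_card (α := Fin _), Fintype.card_fin, AdjoinRoot.powerBasis_dim]
  haveI : Fact (Irreducible γ) := ⟨hγ⟩
  haveI := P.finite_residueField
  haveI := P'.finite_residueField
  set ι := IsLocalRing.ResidueField.map (resHom P P' hBP) with hι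
  -- `F_P[T]/(γ) → F'_{P'}`
  have hz' : eval₂ ι (IsLocalRing.residue P'.toValuationSubring z) γ = 0 := by
    rwa [coe_aeval_eq_eval, eval_map] at hz
  set θ : AdjoinRoot γ →+* P'.residueField :=
    AdjoinRoot.lift ι (IsLocalRing.residue P'.toValuationSubring z) hz' with hθ
  have hcard := Nat.card_le_card_of_injective θ θ.injective
  rw [hL, natCard_residueField P, natCard_residueField P', ← pow_mul] at hcard
  rw [mul_comm]
  exact (Nat.pow_le_pow_iff_right Finite.one_lt_card).1 hcard

end PlaceOver

end Literature.NumberTheory.DiophantineGeometry.AlgFunctionField
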